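import Summits.AtomisticToContinuum.HydrodynamicLimit.Theorems.BoxDissipativeWeakStrongEntropyAdmissibilityStubConcentrationOfPTBC
import Summits.AtomisticToContinuum.HydrodynamicLimit.Theorems.BoxDissipativeWeakStrongEntropyAdmissibilityDynamicCore

/-!
# Crux `EntropyAdmissibility` (stmt-AtomisticToContinuum-9903), line `registered` — stub `stub_macroConcentration_of_PTBCInBand`

Registered stub (r11; necessity-type bookkeeping) of the line `registered` of the crux
`Summit.AtomisticToContinuum.HydrodynamicLimit.Theses.BoxDissipativeWeakStrong.EntropyAdmissibility`:
**S2a' ⇒ positive-time concentration of the MACROSCOPIC empirical fields.** The in-band positive-time box concentration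
S2a' (the line's open fluctuation stub `Sig.stub_positiveTimeBoxConcentrationInBand`, here the ANTECEDENT of an
implication) gives, with `G(r, m, e) = r` (resp. `G = m_k`) and `ψ = χ`, concentration about the mean in `L¹(P_N)` of
`∫ ρ̂_t χ dx` (resp. `∫ m̂_{t,k} χ dx`) at each fixed `t ∈ [0, T)`; these box functionals are, up to a DETERMINISTIC
`o(1)`, the macroscopic empirical fields `(N+1)⁻¹ Σᵢ χ(qᵢ)` and `(N+1)⁻¹ Σᵢ χ(qᵢ) vᵢ,ₖ` of `Φ_t z`:
`∫ ρ̂(z, x) χ(x) dx = (N+1)⁻¹ Σᵢ (K_ℓ ⋆ χ)(qᵢ)` and `|(K_ℓ ⋆ χ)(q) − χ(q)| ≤ ω_χ(ℓ/2)` (the box is the open sup-metric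
ball of radius `ℓ/2`, `∫ K_ℓ(x, q) dx = 1`; `LGFS.abs_integral_kernel_mul_sub_le`), so the gap is `≤ ω_χ(ℓ_N/2)` for the
density and `≤ ω_χ(ℓ_N/2)(N+1)⁻¹Σ‖vᵢ‖ ≤ ω_χ(ℓ_N/2)(1 + (N+1)⁻¹Σ‖vᵢ‖²)` for the momentum (energy is conserved along the
flow regularised off its null bad set, `EABirthS2b.sum_norm_sq_gflow`, and `E_{P_N}[(N+1)⁻¹Σ‖vᵢ‖²] ≤ K`,
`EABirthS2bA.exists_lintegral_meanKinetic_le`); uniform continuity of `χ` on the compact torus and `ℓ_N → 0` give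
`E|X_N − Y_N| → 0`, and `E|Y − E Y| ≤ 2(E|Y − X| + E|X − E X|)`. So no line should expect S2a' to be easier than the
law-of-large-numbers half of the hydrodynamic limit at positive times.

References: H. Spohn, *Large Scale Dynamics of Interacting Particles* (1991), Part I Ch. 3; J. Březina, E. Feireisl,
J. Math. Soc. Japan 70 (2018), Def. 2.9, §3.2. prover-line-stmt-AtomisticToContinuum-9903-c2-0 (worker MACRO).
-/

noncomputable section

open MeasureTheory Filter Set
open scoped ENNReal Topology

namespace Summit.AtomisticToContinuum.HydrodynamicLimit.Theorems.EABirthMacro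

open Literature.MathematicalPhysics.KineticTheory
open Summit.AtomisticToContinuum.HydrodynamicLimit.Theses
open Summit.AtomisticToContinuum.HydrodynamicLimit.Theorems.BDWS
open Summit.AtomisticToContinuum.HydrodynamicLimit.Theorems.EABirthCore (Conclusion InFrame)
open Literature.Analysis.FluidPDE (Config)
open EABirthS2bA EABirthS2b

/-! ## Abstract `L¹(P_N)` bookkeeping -/

section Conc

variable {Ω : ℕ → Type*} [∀ N, MeasurableSpace (Ω N)] (P : ∀ N, Measure (Ω N))

/-- A sequence in `ℝ≥0∞` that is eventually `≤ ofReal (C ε)` for every `ε > 0` tends to `0`. -/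
theorem tendsto_zero_of_forall_eventually_le {u : ℕ → ℝ≥0∞} {C : ℝ} (hC : 0 ≤ C)
    (h : ∀ ε : ℝ, 0 < ε → ∀ᶠ N in atTop, u N ≤ ENNReal.ofReal (C * ε)) : Tendsto u atTop (𝓝 0) := by
  refine ENNReal.tendsto_nhds_zero.2 fun e he => ?_
  rcases eq_or_ne e ⊤ with rfl | hne
  · exact Eventually.of_forall fun N => le_top
  have he' : 0 < e.toReal := ENNReal.toReal_pos he.ne' hne
  filter_upwards [h (e.toReal / (C + 1)) (div_pos he' (by linarith))] with N hN
  refine hN.trans ?_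
  calc ENNReal.ofReal (C * (e.toReal / (C + 1))) ≤ ENNReal.ofReal e.toReal := by
        refine ENNReal.ofReal_le_ofReal ?_
        rw [mul_div_assoc', div_le_iff₀ (by linarith)]
        nlinarith
    _ = e := ENNReal.ofReal_toReal hne

/-- **`E ofReal d_N → 0` from an `ε`-affine bound.** On probability spaces: if for every `ε > 0`, eventually
`d_N ≤ ε (1 + W_N)` pointwise, with `W_N ≥ 0` and `E W_N ≤ K` uniformly in `N`, then `∫⁻ ofReal d_N dP_N → 0`. -/
theorem tendsto_lintegral_of_le_eps_affine (hP : ∀ N, IsProbabilityMeasure (P N)) {d W : ∀ N, Ω N → ℝ} {K : ℝ}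
    (hK : 0 ≤ K) (hW0 : ∀ N z, 0 ≤ W N z) (hWK : ∀ N, ∫⁻ z, ENNReal.ofReal (W N z) ∂P N ≤ ENNReal.ofReal K)
    (h : ∀ ε : ℝ, 0 < ε → ∀ᶠ N in atTop, ∀ z, d N z ≤ ε * (1 + W N z)) :
    Tendsto (fun N => ∫⁻ z, ENNReal.ofReal (d N z) ∂P N) atTop (𝓝 0) := by
  refine tendsto_zero_of_forall_eventually_le (C := 1 + K) (by positivity) fun ε hε => ?_
  filter_upwards [h ε hε] with N hN
  haveI := hP N
  calc ∫⁻ z, ENNReal.ofReal (d N z) ∂P N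
      ≤ ∫⁻ z, (ENNReal.ofReal ε + ENNReal.ofReal ε * ENNReal.ofReal (W N z)) ∂P N :=
        lintegral_mono fun z => by
          rw [← ENNReal.ofReal_mul hε.le, ← ENNReal.ofReal_add hε.le (mul_nonneg hε.le (hW0 N z))]
          exact ENNReal.ofReal_le_ofReal ((hN z).trans_eq (by ring))
    _ = ENNReal.ofReal ε + ENNReal.ofReal ε * ∫⁻ z, ENNReal.ofReal (W N z) ∂P N := by
        rw [lintegral_add_left measurable_const, lintegral_const, measure_univ, mul_one,
          lintegral_const_mul' _ _ ENNReal.ofReal_ne_top]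
    _ ≤ ENNReal.ofReal ε + ENNReal.ofReal ε * ENNReal.ofReal K := add_le_add le_rfl (mul_le_mul' le_rfl (hWK N))
    _ = ENNReal.ofReal ((1 + K) * ε) := by
        rw [← ENNReal.ofReal_mul hε.le, ← ENNReal.ofReal_add hε.le (by positivity)]
        congr 1; ring

/-- **Concentration passes to `L¹`-close sequences.** On probability spaces: if `f_N` concentrates about its mean in
`L¹(P_N)` and `E|g_N − f_N| → 0` (`f_N`, `g_N` integrable), then `g_N` concentrates about its mean
(`E|g − E g| ≤ 2 E|g − E f| ≤ 2 (E|g − f| + E|f − E f|)`, `EABirthS2bA.lintegral_ofReal_abs_sub_integral_le`). -/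
theorem tendsto_conc_of_tendsto_sub (hP : ∀ N, IsProbabilityMeasure (P N)) {f g : ∀ N, Ω N → ℝ}
    (hf : ∀ N, Integrable (f N) (P N)) (hg : ∀ N, Integrable (g N) (P N))
    (hconc : Tendsto (fun N => ∫⁻ z, ENNReal.ofReal |f N z - ∫ z', f N z' ∂P N| ∂P N) atTop (𝓝 0))
    (hsub : Tendsto (fun N => ∫⁻ z, ENNReal.ofReal |g N z - f N z| ∂P N) atTop (𝓝 0)) :
    Tendsto (fun N => ∫⁻ z, ENNReal.ofReal |g N z - ∫ z', g N z' ∂P N| ∂P N) atTop (𝓝 0) := by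
  have hsum : Tendsto (fun N => 2 * ((∫⁻ z, ENNReal.ofReal |g N z - f N z| ∂P N) +
      ∫⁻ z, ENNReal.ofReal |f N z - ∫ z', f N z' ∂P N| ∂P N)) atTop (𝓝 0) := by
    have h2 := ENNReal.Tendsto.const_mul (hsub.add hconc) (Or.inr ENNReal.ofNat_ne_top) (a := 2)
    simpa only [add_zero, mul_zero] using h2
  refine tendsto_of_tendsto_of_tendsto_of_le_of_le' tendsto_const_nhds hsum
    (Eventually.of_forall fun N => bot_le) (Eventually.of_forall fun N => ?_)
  haveI := hP N
  refine (lintegral_ofReal_abs_sub_integral_le (P N) (hg N) (∫ z', f N z' ∂P N)).trans (mul_le_mul' le_rfl ?_)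
  have hmeas : AEMeasurable (fun z => ENNReal.ofReal |g N z - f N z|) (P N) :=
    (continuous_abs.measurable.comp_aemeasurable
      ((hg N).aestronglyMeasurable.aemeasurable.sub (hf N).aestronglyMeasurable.aemeasurable)).ennreal_ofReal
  calc ∫⁻ z, ENNReal.ofReal |g N z - ∫ z', f N z' ∂P N| ∂P N
      ≤ ∫⁻ z, (ENNReal.ofReal |g N z - f N z| + ENNReal.ofReal |f N z - ∫ z', f N z' ∂P N|) ∂P N :=
        lintegral_mono fun z => by
          rw [← ENNReal.ofReal_add (abs_nonneg _) (abs_nonneg _)]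
          exact ENNReal.ofReal_le_ofReal (abs_sub_le _ _ _)
    _ = _ := lintegral_add_left' hmeas _

end Conc

/-! ## Statics: the box functionals of `G = r`, `G = m_k` versus the macroscopic empirical fields -/

section Statics

variable {N : ℕ} {l : ℝ} {χ : T3 → ℝ}

/-- The box kernel is measurable in its centre `x`. -/
theorem measurable_boxKernel_left (l : ℝ) (q : T3) : Measurable fun x : T3 => boxKernel l x q := by
  have hk : Measurable fun p : T3 × T3 => boxKernel l p.1 p.2 := LGFS.measurable_boxK_uncurry l
  exact hk.comp (f := fun x : T3 => (x, q)) (measurable_id.prodMk measurable_const)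

/-- `x ↦ K_l(x, q) χ(x)` is integrable for continuous `χ` (`0 ≤ K_l ≤ l⁻³`, `χ` bounded). -/
theorem integrable_boxKernel_mul (hl : 0 ≤ l) (hχ : Continuous χ) (q : T3) :
    Integrable fun x : T3 => boxKernel l x q * χ x := by
  obtain ⟨B, -, hB⟩ := exists_forall_abs_le_of_continuous hχ
  exact LGFS.integrable_kernel_mul (g := fun x => boxKernel l x q) (measurable_boxKernel_left l q)
    (fun x => LGFS.boxK_nonneg hl x q) (fun x => LGFS.boxK_le hl x q) hχ.measurable hB

/-- **Averaging**: `|∫ K_l(x, q) χ(x) dx − χ(q)| ≤ η` whenever `χ` varies by at most `η` at sup-distance `< l/2`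
(the box `{∀ i, ‖qᵢ − xᵢ‖ < l/2}` is the open sup-metric ball of radius `l/2`; `∫ K_l(x, q) dx = 1` for `0 < l ≤ 1`). -/
theorem abs_integral_boxKernel_mul_sub_le (hl : 0 < l) (hl1 : l ≤ 1) (hχ : Continuous χ) {η : ℝ}
    (hmod : ∀ x y : T3, dist x y < l / 2 → |χ x - χ y| ≤ η) (q : T3) : |(∫ x, boxKernel l x q * χ x) - χ q| ≤ η := by
  obtain ⟨B, -, hB⟩ := exists_forall_abs_le_of_continuous hχ
  exact LGFS.abs_integral_kernel_mul_sub_le (g := fun x => boxKernel l x q) (measurable_boxKernel_left l q)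
    (fun x => LGFS.boxK_nonneg hl.le x q) (fun x => LGFS.boxK_le hl.le x q) (integral_boxKernel_left hl hl1 q)
    (fun x hx => by rw [dist_comm]; exact LGFS.dist_lt_of_boxK_ne_zero hl hx) hχ.measurable hB
    fun x hx => hmod x q hx

/-- `∫ ρ̂(w, x) χ(x) dx = (N+1)⁻¹ Σᵢ ∫ K_l(x, qᵢ) χ(x) dx` for every configuration `w`. -/
theorem integral_density_mul (hl : 0 ≤ l) (hχ : Continuous χ) (w : Config (N + 1) (Fin 3) T3) :
    ∫ x, empiricalDensityField w (boxKernel l x) * χ x =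
      ((N : ℝ) + 1)⁻¹ * ∑ i, ∫ x, boxKernel l x (w i).1 * χ x := by
  have h1 : ∀ x, empiricalDensityField w (boxKernel l x) * χ x =
      ((N : ℝ) + 1)⁻¹ * ∑ i, boxKernel l x (w i).1 * χ x := fun x => by
    rw [empiricalDensityField_eq_sum, Nat.cast_add_one, mul_assoc, Finset.sum_mul]
  simp_rw [h1]
  rw [integral_const_mul, integral_finsetSum _ fun i _ => integrable_boxKernel_mul hl hχ (w i).1]

/-- The `k`-th component of the empirical momentum field is the average `(N+1)⁻¹ Σᵢ χ(qᵢ) vᵢ,ₖ`. -/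
theorem empiricalMomentumField_apply (w : Config (N + 1) (Fin 3) T3) (χ : T3 → ℝ) (k : Fin 3) :
    empiricalMomentumField w χ k = ((N : ℝ) + 1)⁻¹ * ∑ i, χ (w i).1 * (w i).2 k := by
  rw [empiricalMomentumField_eq_sum, Nat.cast_add_one]
  simp only [PiLp.smul_apply, WithLp.ofLp_sum, Finset.sum_apply, smul_eq_mul]

/-- `∫ m̂ₖ(w, x) χ(x) dx = (N+1)⁻¹ Σᵢ (∫ K_l(x, qᵢ) χ(x) dx) vᵢ,ₖ` for every configuration `w`. -/
theorem integral_momentum_apply_mul (hl : 0 ≤ l) (hχ : Continuous χ) (w : Config (N + 1) (Fin 3) T3) (k : Fin 3) :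
    ∫ x, empiricalMomentumField w (boxKernel l x) k * χ x =
      ((N : ℝ) + 1)⁻¹ * ∑ i, (∫ x, boxKernel l x (w i).1 * χ x) * (w i).2 k := by
  have h1 : ∀ x, empiricalMomentumField w (boxKernel l x) k * χ x =
      ((N : ℝ) + 1)⁻¹ * ∑ i, boxKernel l x (w i).1 * χ x * (w i).2 k := fun x => by
    rw [empiricalMomentumField_apply, mul_assoc, Finset.sum_mul]
    exact congrArg _ (Finset.sum_congr rfl fun i _ => by ring)
  simp_rw [h1]
  rw [integral_const_mul, integral_finsetSum _ fun i _ => (integrable_boxKernel_mul hl hχ (w i).1).mul_const _]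
  simp_rw [integral_mul_const]

/-- `|(N+1)⁻¹ Σᵢ fᵢ| ≤ (N+1)⁻¹ Σᵢ gᵢ` whenever `|fᵢ| ≤ gᵢ`. -/
theorem abs_avg_le_avg {f g : Fin (N + 1) → ℝ} (hf : ∀ i, |f i| ≤ g i) :
    |((N : ℝ) + 1)⁻¹ * ∑ i, f i| ≤ ((N : ℝ) + 1)⁻¹ * ∑ i, g i := by
  rw [abs_mul, abs_of_pos (by positivity : (0 : ℝ) < ((N : ℝ) + 1)⁻¹)]
  exact mul_le_mul_of_nonneg_left ((Finset.abs_sum_le_sum_abs _ _).trans (Finset.sum_le_sum fun i _ => hf i))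
    (by positivity)

/-- `|(N+1)⁻¹ Σᵢ fᵢ| ≤ B` whenever `|fᵢ| ≤ B`. -/
theorem abs_avg_le {f : Fin (N + 1) → ℝ} {B : ℝ} (hf : ∀ i, |f i| ≤ B) : |((N : ℝ) + 1)⁻¹ * ∑ i, f i| ≤ B := by
  refine (abs_avg_le_avg hf).trans_eq ?_
  rw [Finset.sum_const, Finset.card_univ, Fintype.card_fin, nsmul_eq_mul, Nat.cast_add_one,
    inv_mul_cancel_left₀ (by positivity)]

/-- **Density**: `|∫ ρ̂(w, x) χ(x) dx − (N+1)⁻¹ Σᵢ χ(qᵢ)| ≤ η` (modulus `η` of `χ` at sup-scale `l/2`). -/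
theorem abs_integral_density_sub_le (hl : 0 < l) (hl1 : l ≤ 1) (hχ : Continuous χ) {η : ℝ}
    (hmod : ∀ x y : T3, dist x y < l / 2 → |χ x - χ y| ≤ η) (w : Config (N + 1) (Fin 3) T3) :
    |(∫ x, empiricalDensityField w (boxKernel l x) * χ x) - empiricalDensityField w χ| ≤ η := by
  rw [integral_density_mul hl.le hχ, empiricalDensityField_eq_sum, Nat.cast_add_one, ← mul_sub,
    ← Finset.sum_sub_distrib]
  exact abs_avg_le fun i => abs_integral_boxKernel_mul_sub_le hl hl1 hχ hmod _

/-- **Momentum**: `|∫ m̂ₖ(w, x) χ(x) dx − (N+1)⁻¹ Σᵢ χ(qᵢ) vᵢ,ₖ| ≤ η (N+1)⁻¹ Σᵢ ‖vᵢ‖` (`η ≥ 0` a modulus as above). -/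
theorem abs_integral_momentum_sub_le (hl : 0 < l) (hl1 : l ≤ 1) (hχ : Continuous χ) {η : ℝ} (hη : 0 ≤ η)
    (hmod : ∀ x y : T3, dist x y < l / 2 → |χ x - χ y| ≤ η) (w : Config (N + 1) (Fin 3) T3) (k : Fin 3) :
    |(∫ x, empiricalMomentumField w (boxKernel l x) k * χ x) - empiricalMomentumField w χ k| ≤
      η * (((N : ℝ) + 1)⁻¹ * ∑ i, ‖(w i).2‖) := by
  have hk : ∀ m : V3, |m k| ≤ ‖m‖ := fun m => by simpa using PiLp.norm_apply_le m k
  rw [integral_momentum_apply_mul hl.le hχ, empiricalMomentumField_apply, ← mul_sub, ← Finset.sum_sub_distrib]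
  calc _ ≤ ((N : ℝ) + 1)⁻¹ * ∑ i, η * ‖(w i).2‖ := abs_avg_le_avg fun i => by
          rw [← sub_mul, abs_mul]
          exact mul_le_mul (abs_integral_boxKernel_mul_sub_le hl hl1 hχ hmod _) (hk _) (abs_nonneg _) hη
    _ = η * (((N : ℝ) + 1)⁻¹ * ∑ i, ‖(w i).2‖) := by rw [← Finset.mul_sum]; ring

/-- `|(N+1)⁻¹ Σᵢ χ(qᵢ)| ≤ B` for `|χ| ≤ B`. -/
theorem abs_empiricalDensityField_le {B : ℝ} (hB : ∀ x, |χ x| ≤ B) (w : Config (N + 1) (Fin 3) T3) :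
    |empiricalDensityField w χ| ≤ B := by
  rw [empiricalDensityField_eq_sum, Nat.cast_add_one]
  exact abs_avg_le fun i => hB _

/-- `|(N+1)⁻¹ Σᵢ χ(qᵢ) vᵢ,ₖ| ≤ B (N+1)⁻¹ Σᵢ ‖vᵢ‖` for `|χ| ≤ B`. -/
theorem abs_empiricalMomentumField_apply_le {B : ℝ} (hB : ∀ x, |χ x| ≤ B) (w : Config (N + 1) (Fin 3) T3)
    (k : Fin 3) : |empiricalMomentumField w χ k| ≤ B * (((N : ℝ) + 1)⁻¹ * ∑ i, ‖(w i).2‖) := by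
  have hB0 : 0 ≤ B := (abs_nonneg _).trans (hB (w 0).1)
  have hk : ∀ m : V3, |m k| ≤ ‖m‖ := fun m => by simpa using PiLp.norm_apply_le m k
  rw [empiricalMomentumField_apply]
  calc _ ≤ ((N : ℝ) + 1)⁻¹ * ∑ i, B * ‖(w i).2‖ := abs_avg_le_avg fun i => by
          rw [abs_mul]
          exact mul_le_mul (hB _) (hk _) (abs_nonneg _) hB0
    _ = B * (((N : ℝ) + 1)⁻¹ * ∑ i, ‖(w i).2‖) := by rw [← Finset.mul_sum]; ring

end Statics

/-! ## From box concentration to macroscopic concentration, at a fixed time -/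

section Frame

variable {σ : ℝ} {a₀ θ₀ : T3 → ℝ} {u₀ : T3 → V3} {Φ : FlowFamily σ} {ℓ : ℕ → ℝ} {K : ℝ} {χ : T3 → ℝ}

/-- The modulus of continuity of a continuous `χ` at the vanishing scales `ℓ_N / 2`: for every `ε > 0`, eventually
`|χ x − χ y| ≤ ε` whenever `dist x y < ℓ_N / 2` (uniform continuity on the compact torus). -/
theorem eventually_modulus (hχ : Continuous χ) (hℓ0 : Tendsto ℓ atTop (𝓝 0)) {ε : ℝ} (hε : 0 < ε) :
    ∀ᶠ N in atTop, ∀ x y : T3, dist x y < ℓ N / 2 → |χ x - χ y| ≤ ε := by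
  obtain ⟨δ, hδ, hδχ⟩ := Metric.uniformContinuous_iff.1 (CompactSpace.uniformContinuous_of_continuous hχ) ε hε
  filter_upwards [(tendsto_order.1 hℓ0).2 (2 * δ) (by positivity)] with N hN x y hxy
  have h := hδχ (lt_of_lt_of_le hxy (by linarith))
  rw [Real.dist_eq] at h
  exact h.le

/-- `(N+1)⁻¹ Σᵢ ‖vᵢ‖ ≤ 1 + (N+1)⁻¹ Σᵢ ‖vᵢ‖²` (`EABirthS2bA.meanNorm_le`). -/
theorem meanNorm_le_one_add {N : ℕ} (w : Config (N + 1) (Fin 3) T3) :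
    ((N : ℝ) + 1)⁻¹ * ∑ i, ‖(w i).2‖ ≤ 1 + ((N : ℝ) + 1)⁻¹ * ∑ i, ‖(w i).2‖ ^ 2 := by
  have h := meanNorm_le w
  have h0 : 0 ≤ ((N : ℝ) + 1)⁻¹ * ∑ i, ‖(w i).2‖ ^ 2 := by positivity
  linarith

/-- **From box concentration to macroscopic concentration, at a fixed time.** In the setting of `EABirthS2b.conc_gflow`
(laws carried by the good sets, windows `0 < ℓ_N ≤ 1`, `ℓ_N → 0`, `E_{P_N} W_N ≤ K` for `W_N = (N+1)⁻¹Σ‖vᵢ‖²`): if the box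
functional `∫ G(Û_t) χ dx` of a linear-growth Borel `G` concentrates about its mean (S2a' at `t`, `G`, `χ`) and the measurable
static functionals `F_N` satisfy `|F_N| ≤ C (1 + W_N)` and `|∫ G(Û(w, x)) χ(x) dx − F_N(w)| ≤ η (1 + W_N(w))` for every
modulus `η ≥ 0` of `χ` at sup-scale `ℓ_N / 2`, then `F_N(Φ_t z)` concentrates about its mean (`W_N` is flow-invariant). -/
theorem tendsto_conc_of_box (hP : ∀ N, IsProbabilityMeasure (localGibbsLaw σ a₀ u₀ θ₀ N (Φ N)))
    (hgood : ∀ N, localGibbsLaw σ a₀ u₀ θ₀ N (Φ N) (Φ N).goodᶜ = 0) (hℓ : ∀ N, 0 < ℓ N ∧ ℓ N ≤ 1)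
    (hℓ0 : Tendsto ℓ atTop (𝓝 0)) (hK : 0 ≤ K)
    (hWK : ∀ N, ∫⁻ z, ENNReal.ofReal (((N : ℝ) + 1)⁻¹ * ∑ i, ‖(z i).2‖ ^ 2) ∂(localGibbsLaw σ a₀ u₀ θ₀ N (Φ N)) ≤
      ENNReal.ofReal K)
    {G : ℝ × V3 × ℝ → ℝ} (hG : Measurable G) (hgr : ∀ p, |G p| ≤ |p.1| + ‖p.2.1‖) (hχ : Continuous χ) (t : ℝ)
    {F : ∀ N : ℕ, Config (N + 1) (Fin 3) T3 → ℝ} (hFm : ∀ N, Measurable (F N)) {C : ℝ}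
    (hFb : ∀ (N : ℕ) (w : Config (N + 1) (Fin 3) T3), |F N w| ≤ C * (1 + ((N : ℝ) + 1)⁻¹ * ∑ i, ‖(w i).2‖ ^ 2))
    (hFX : ∀ (η : ℝ) (N : ℕ), 0 ≤ η → (∀ x y : T3, dist x y < ℓ N / 2 → |χ x - χ y| ≤ η) →
      ∀ w : Config (N + 1) (Fin 3) T3,
        |(∫ x, G (fields (ℓ N) w x) * χ x) - F N w| ≤ η * (1 + ((N : ℝ) + 1)⁻¹ * ∑ i, ‖(w i).2‖ ^ 2))
    (hT : Tendsto (fun N : ℕ => ∫⁻ z, ENNReal.ofReal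
      |(∫ x, G (boxDensity σ ℓ Φ N t z x, boxMomentum σ ℓ Φ N t z x, boxEnergy σ ℓ Φ N t z x) * χ x) -
        ∫ z', (∫ x, G (boxDensity σ ℓ Φ N t z' x, boxMomentum σ ℓ Φ N t z' x, boxEnergy σ ℓ Φ N t z' x) * χ x)
          ∂(localGibbsLaw σ a₀ u₀ θ₀ N (Φ N))| ∂(localGibbsLaw σ a₀ u₀ θ₀ N (Φ N))) atTop (𝓝 0)) :
    Tendsto (fun N : ℕ => ∫⁻ z, ENNReal.ofReal
        |F N ((Φ N).flow t z) - ∫ z', F N ((Φ N).flow t z') ∂(localGibbsLaw σ a₀ u₀ θ₀ N (Φ N))|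
      ∂(localGibbsLaw σ a₀ u₀ θ₀ N (Φ N))) atTop (𝓝 0) := by
  set P : ∀ N : ℕ, Measure (Config (N + 1) (Fin 3) T3) := fun N => localGibbsLaw σ a₀ u₀ θ₀ N (Φ N)
  obtain ⟨hXi, hXc⟩ := conc_gflow hP hgood hℓ hK hWK hG hgr hχ t hT
  set X : ∀ N : ℕ, Config (N + 1) (Fin 3) T3 → ℝ := fun N z =>
    ∫ x, G (fields (ℓ N) (gflow (Φ N) t z) x) * χ x
  set Y : ∀ N : ℕ, Config (N + 1) (Fin 3) T3 → ℝ := fun N z => F N (gflow (Φ N) t z) with hY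
  have hWg : ∀ (N : ℕ) (z : Config (N + 1) (Fin 3) T3),
      ((N : ℝ) + 1)⁻¹ * ∑ i, ‖(gflow (Φ N) t z i).2‖ ^ 2 = ((N : ℝ) + 1)⁻¹ * ∑ i, ‖(z i).2‖ ^ 2 := fun N z => by
    rw [sum_norm_sq_gflow (Φ N) t z]
  have hgt : ∀ N, Measurable (gflow (Φ N) t) := fun N =>
    (measurable_gflow (Φ N)).comp (measurable_const.prodMk measurable_id)
  have hYi : ∀ N, Integrable (Y N) (P N) := fun N => by
    haveI := hP N
    refine integrable_of_abs_le_affine (C := C) (D := C) ((hFm N).comp (hgt N)).aestronglyMeasurable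
      (integrable_of_lintegral_ofReal_le (by fun_prop) (fun z => by positivity) hK (hWK N)).1 fun z => ?_
    have h := hFb N (gflow (Φ N) t z)
    rw [hWg] at h
    exact h.trans_eq (by ring)
  have hsub : Tendsto (fun N => ∫⁻ z, ENNReal.ofReal |Y N z - X N z| ∂P N) atTop (𝓝 0) := by
    refine tendsto_lintegral_of_le_eps_affine P hP (d := fun N z => |Y N z - X N z|)
      (W := fun N (z : Config (N + 1) (Fin 3) T3) => ((N : ℝ) + 1)⁻¹ * ∑ i, ‖(z i).2‖ ^ 2)
      hK (fun N z => by positivity) hWK fun ε hε => ?_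
    filter_upwards [eventually_modulus hχ hℓ0 hε] with N hN z
    rw [abs_sub_comm]
    calc |X N z - Y N z| ≤ ε * (1 + ((N : ℝ) + 1)⁻¹ * ∑ i, ‖(gflow (Φ N) t z i).2‖ ^ 2) := hFX ε N hε.le hN _
      _ = ε * (1 + ((N : ℝ) + 1)⁻¹ * ∑ i, ‖(z i).2‖ ^ 2) := by rw [hWg]
  refine tendsto_conc_congr_ae P (fun N => ?_) (tendsto_conc_of_tendsto_sub P hP hXi hYi hXc hsub)
  filter_upwards [gflow_ae_eq (Φ N) (hgood N)] with z hz
  simp only [hY, hz t]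

end Frame

/-! ## The stub -/

/-- The MACROSCOPIC concentration conclusion (verbatim the skeleton's `Cmacro`): at every `t ∈ [0, T)` and for every
continuous `χ`, the empirical density field `empiricalDensityField (Φ_t z) χ` and each component of the empirical
momentum field `empiricalMomentumField (Φ_t z) χ k` concentrate about their means in `L¹(P_N)`. -/
def Cmacro : Conclusion := fun σ _η₁ a₀ θ₀ u₀ T _ρ _θ _u Φ _ℓ _τ _a _b _φ =>
  ∀ t ∈ Ico 0 T, ∀ χ : T3 → ℝ, Continuous χ →
    Tendsto (fun N : ℕ => ∫⁻ z, ENNReal.ofReal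
        |empiricalDensityField ((Φ N).flow t z) χ -
          ∫ z', empiricalDensityField ((Φ N).flow t z') χ ∂(localGibbsLaw σ a₀ u₀ θ₀ N (Φ N))|
      ∂(localGibbsLaw σ a₀ u₀ θ₀ N (Φ N))) atTop (𝓝 0) ∧
    ∀ k : Fin 3, Tendsto (fun N : ℕ => ∫⁻ z, ENNReal.ofReal
        |empiricalMomentumField ((Φ N).flow t z) χ k -
          ∫ z', empiricalMomentumField ((Φ N).flow t z') χ k ∂(localGibbsLaw σ a₀ u₀ θ₀ N (Φ N))|
      ∂(localGibbsLaw σ a₀ u₀ θ₀ N (Φ N))) atTop (𝓝 0)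

/-- **S2a' is at least conjunct-fluctuation-strength (r11; necessity-type bookkeeping, size S–M, provable now).** Signature of the
registered stub — definitionally the skeleton's `Sig.stub_positiveTimeBoxConcentrationInBand → InFrame Cmacro`, the antecedent S2a'
(the line's OPEN in-band positive-time box concentration) inlined verbatim, as in `EABirthS2bG` / `EABirthAssembly`.
`S2a' → InFrame Cmacro`: the in-band positive-time box concentration implies positive-time concentration of the MACROSCOPIC empirical
density and momentum fields about their means (take `G = r`, resp. `G = m_k`, `ψ = χ` in S2a'; the box functional
`∫ ρ̂_t(z,x) χ(x) dx = (N+1)⁻¹ Σᵢ (K_ℓ ⋆ χ)(qᵢ(t))` differs from `empiricalDensityField (Φ_t z) χ = (N+1)⁻¹ Σᵢ χ(qᵢ(t))` by at most the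
modulus of continuity of `χ` at scale `ℓ_N` — the box `{∀ i, ‖yᵢ − xᵢ‖ < ℓ/2}` is the sup-metric ball — deterministically, and for the
momentum by that modulus times `(N+1)⁻¹ Σ‖vᵢ‖`, whose mean is bounded by the conserved kinetic energy). So no line should expect S2a' to
be easier than the law-of-large-numbers half of the hydrodynamic limit at positive times. -/
def Sig.stub_macroConcentration_of_PTBCInBand : Prop :=
  (BoxDissipativeWeakStrong.HsEosLowDensity →
    ∃ ηc : ℝ, 0 < ηc ∧ ∀ η₁ : ℝ, 0 < η₁ → η₁ < ηc →
      ∀ (a₀ θ₀ : T3 → ℝ) (u₀ : T3 → V3), Continuous a₀ → Continuous θ₀ → Continuous u₀ →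
        (∀ x, 0 < a₀ x) → (∀ x, 0 < θ₀ x) →
        ∃ σ₀ : ℝ, 0 < σ₀ ∧ ∀ σ : ℝ, 0 < σ → σ < σ₀ →
          ∀ (T : ℝ) (ρ θ : ℝ → T3 → ℝ) (u : ℝ → T3 → V3), IsHardSphereEulerSolution σ T ρ u θ →
            (∀ t ∈ Ico 0 T, ∀ x, ρ t x * σ ^ 3 ≤ η₁ / 2) →
            ∀ Φ : FlowFamily σ,
              TendstoHydroFieldsAt (fun N => localGibbsLaw σ a₀ u₀ θ₀ N (Φ N)) Φ ρ u θ 0 →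
              ∀ ℓ : ℕ → ℝ, (∀ N, 0 < ℓ N ∧ ℓ N ≤ 1) → Tendsto ℓ atTop (𝓝 0) →
                Tendsto (fun N : ℕ => ℓ N ^ 3 * ((N : ℝ) + 1)) atTop atTop →
                ∀ t ∈ Ico 0 T, ∀ G : ℝ × V3 × ℝ → ℝ, Measurable G → (∀ p, |G p| ≤ |p.1| + ‖p.2.1‖) →
                  ∀ ψ : T3 → ℝ, Continuous ψ →
                    Tendsto (fun N : ℕ => ∫⁻ z, ENNReal.ofReal
                        |(∫ x, G (boxDensity σ ℓ Φ N t z x, boxMomentum σ ℓ Φ N t z x,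
                            boxEnergy σ ℓ Φ N t z x) * ψ x) -
                          ∫ z', (∫ x, G (boxDensity σ ℓ Φ N t z' x, boxMomentum σ ℓ Φ N t z' x,
                            boxEnergy σ ℓ Φ N t z' x) * ψ x) ∂(localGibbsLaw σ a₀ u₀ θ₀ N (Φ N))|
                      ∂(localGibbsLaw σ a₀ u₀ θ₀ N (Φ N))) atTop (𝓝 0)) →
    InFrame Cmacro

/-- **Registered stub `stub_macroConcentration_of_PTBCInBand`** (crux stmt-AtomisticToContinuum-9903, line `registered`):
S2a' implies, in the crux's frame, positive-time `L¹(P_N)`-concentration about the mean of the macroscopic empirical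
density field and of each component of the empirical momentum field, for every `t ∈ [0, T)` and continuous `χ`.
Thresholds: `ηc := ηc(S2a')`, `σ₀ := min σ₀(S2a') (1/2)` (so that `P_N` is a probability measure). -/
theorem stub_macroConcentration_of_PTBCInBand : Sig.stub_macroConcentration_of_PTBCInBand := by
  intro hS2a hEos
  obtain ⟨ηc, hηc, H⟩ := hS2a hEos
  refine ⟨ηc, hηc, fun η₁ hη₁ hη₁c a₀ θ₀ u₀ ha hθ hu ha0 hθ0 => ?_⟩
  obtain ⟨σ₁, hσ₁, H₁⟩ := H η₁ hη₁ hη₁c a₀ θ₀ u₀ ha hθ hu ha0 hθ0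
  refine ⟨min σ₁ (1 / 2), lt_min hσ₁ one_half_pos, ?_⟩
  intro σ hσ hσlt T ρ θ u hsol hguard Φ hLLN ℓ hℓ hℓ0 hℓ3 τ _ a b _ φ _ _
  dsimp only [Cmacro]
  intro t ht χ hχ
  have HH := H₁ σ hσ (hσlt.trans_le (min_le_left _ _)) T ρ θ u hsol hguard Φ hLLN ℓ hℓ hℓ0 hℓ3 t ht
  have hP : ∀ N, IsProbabilityMeasure (localGibbsLaw σ a₀ u₀ θ₀ N (Φ N)) := fun N =>
    isProbabilityMeasure_localGibbsLaw ha hθ hu ha0 hθ0 (hσlt.trans_le (min_le_right _ _)).le N (Φ N)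
  have hgood : ∀ N, localGibbsLaw σ a₀ u₀ θ₀ N (Φ N) (Φ N).goodᶜ = 0 := fun N => by
    rw [localGibbsLaw_eq]
    exact localGibbsMeasure_absolutelyContinuous σ a₀ u₀ θ₀ N (Φ N) (Φ N).measure_compl_good
  obtain ⟨K, hK, hWK⟩ := exists_lintegral_meanKinetic_le ha hθ hu (fun x => (ha0 x).le) hθ0
  have hWK' := fun N => hWK σ N (Φ N)
  obtain ⟨B, hB0, hB⟩ := exists_forall_abs_le_of_continuous hχ
  have hW1 : ∀ (N : ℕ) (w : Config (N + 1) (Fin 3) T3), (1 : ℝ) ≤ 1 + ((N : ℝ) + 1)⁻¹ * ∑ i, ‖(w i).2‖ ^ 2 :=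
    fun N w => le_add_of_nonneg_right (by positivity)
  -- density: `G = r`, `F_N(w) = (N+1)⁻¹ Σ χ(qᵢ)`; momentum: `G = m_k`, `F_N(w) = (N+1)⁻¹ Σ χ(qᵢ) vᵢ,ₖ`
  refine ⟨?_, fun k => ?_⟩
  · exact tendsto_conc_of_box hP hgood hℓ hℓ0 hK hWK' (G := fun p => p.1) measurable_fst
      (fun p => le_add_of_nonneg_right (norm_nonneg _)) hχ t (F := fun N w => empiricalDensityField w χ)
      (fun N => LGFS.measurable_empiricalDensityField hχ.measurable) (C := B)
      (fun N w => (abs_empiricalDensityField_le hB w).trans (le_mul_of_one_le_right hB0 (hW1 N w)))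
      (fun η N hη hmod w => (abs_integral_density_sub_le (hℓ N).1 (hℓ N).2 hχ hmod w).trans
        (le_mul_of_one_le_right hη (hW1 N w)))
      (HH (fun p => p.1) measurable_fst (fun p => le_add_of_nonneg_right (norm_nonneg _)) χ hχ)
  · have hG : Measurable fun p : ℝ × V3 × ℝ => p.2.1 k :=
      (show Measurable fun m : V3 => m k by fun_prop).comp (measurable_fst.comp measurable_snd)
    have hgr : ∀ p : ℝ × V3 × ℝ, |(fun p : ℝ × V3 × ℝ => p.2.1 k) p| ≤ |p.1| + ‖p.2.1‖ := fun p =>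
      (by simpa using PiLp.norm_apply_le p.2.1 k : |p.2.1 k| ≤ ‖p.2.1‖).trans (le_add_of_nonneg_left (abs_nonneg _))
    exact tendsto_conc_of_box hP hgood hℓ hℓ0 hK hWK' hG hgr hχ t (F := fun N w => empiricalMomentumField w χ k)
      (fun N => (show Measurable fun m : V3 => m k by fun_prop).comp
        (LGFS.measurable_empiricalMomentumField hχ.measurable)) (C := B)
      (fun N w => (abs_empiricalMomentumField_apply_le hB w k).trans
        (mul_le_mul_of_nonneg_left (meanNorm_le_one_add w) hB0))
      (fun η N hη hmod w => (abs_integral_momentum_sub_le (hℓ N).1 (hℓ N).2 hχ hη hmod w k).trans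
        (mul_le_mul_of_nonneg_left (meanNorm_le_one_add w) hη))
      (HH (fun p => p.2.1 k) hG hgr χ hχ)

end Summit.AtomisticToContinuum.HydrodynamicLimit.Theorems.EABirthMacro

end
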